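import Literature.MathematicalPhysics.QuantumLattice.HubbardUVSymbolJetsGeometric
import Literature.MathematicalPhysics.QuantumLattice.HubbardUVWeightJetsGeometric
import Literature.Analysis.Calculus.IteratedDerivCompGevrey
import Literature.Analysis.Calculus.IteratedDerivMulFactorialPow
import HarnessLib

/-!
# Gevrey-2 envelopes of the ultraviolet weight and symbol jets with an `X`-FREE ratio:
# `‖∂ⁿ w(ω,·)‖ ≤ X₀·(n!)²·(16(1+C_χ)/Λ)ⁿ`, `‖∂ⁿ Ψ(ω,·)‖ ≤ X₀·|c|(2/Λ)·(n!)²·(32(1+C_χ)/Λ)ⁿ` everywhere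

Topic `MathematicalPhysics/QuantumLattice`; the Gevrey-class companion of `HubbardUVWeightJetsGeometric` / `HubbardUVSymbolJetsGeometric`.  Those envelopes
read the cutoff through a FLAT table `‖χ₂^{(l)}‖ ≤ X` (`l ≤ n`) and carry the full `X = X_n` — which for a compactly supported `C^∞` cutoff grows like
`(n!)²` — in every downstream constant (cell gate-hubbard-kl, located risk «(C)-B-ALIAS-L»: the aliasing threshold of the sup route then fails to sit under
the registered volume door).  With the cutoff in the Gevrey-2 class, `‖χ₂^{(l)}‖ ≤ X₀·(l!)²·C_χ^l` (standard constructive-RG practice: Disertori–Rivasseau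
2000, Part I, footnote to (II.13) and App. A Lemma 11, choose a Gevrey cutoff for the stretched-exponential decay it buys; Benfatto–Giuliani–Mastropietro
2006 §2.2 (2.9) only asks for a smooth compact-support function, and Salmhofer's `χ₂`, built from `e^{−1/x}`, is in the class), the composition lemma
`Literature.Analysis.Calculus.norm_iteratedFDeriv_comp_le_of_gevrey_two` keeps the squared factorial and puts only `C_χ` (not `X_n`) into the geometric ratio:

* **`norm_iteratedFDeriv_uvWeightFn_band_le_gevrey`** — `‖∂ⁿw(ω,·)(e)‖ ≤ X₀·(n!)²·(16(1+C_χ)/Λ)ⁿ` at EVERY `e` (`0 < Λ`, `1 ≤ X₀`, `0 ≤ C_χ`);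
* `norm_iteratedFDeriv_resolventFnXi_le_of_halfShell` — `‖∂ⁿR(e)‖ ≤ |c|(2/Λ)·(n!)²·(2/Λ)ⁿ` on `Λ²/4 ≤ ω² + e²`;
* **`norm_iteratedFDeriv_uvSymbolFnXi_le_gevrey`** — `‖∂ⁿΨ(ω,e)‖ ≤ X₀·(|c|(2/Λ))·(n!)²·(2·16(1+C_χ)/Λ)ⁿ` at EVERY `e` (`ω ≠ 0`).

Everything is proved; no definitions; no named facts (the Gevrey table of the cutoff is a hypothesis, like the flat table before).

## Sources

G. Benfatto, A. Giuliani, V. Mastropietro, Ann. Henri Poincaré 7 (2006) 809–898, §2.2 (2.9), §2.3 (2.36aa), §3 (3.2) [`BenfattoGiulianiMastropietro2006`];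
M. Disertori, V. Rivasseau, Commun. Math. Phys. 215 (2000) 251–290, §II (II.13) footnote, App. A Lemma 11 [`DisertoriRivasseau2000`; the Gevrey-cutoff device];
M. Salmhofer, *Renormalization*, Springer 1999, §4.2.5 (4.70)–(4.71) [`Salmhofer1999`].
-/

noncomputable section

namespace Literature.MathematicalPhysics.QuantumLattice

open Complex Finset Literature.Analysis.Calculus
open scoped Nat

variable {c Λ ω : ℝ}

/-- **GEVREY-2 ENVELOPE OF THE WEIGHT JETS, EVERYWHERE**: `‖∂ⁿ w(ω,·)(e)‖ ≤ X₀·(n!)²·(16(1+C_χ)/Λ)ⁿ` (`0 < Λ`, Gevrey table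
`‖χ₂^{(l)}‖ ≤ X₀(l!)²C_χ^l` for `l ≤ n`, `1 ≤ X₀`, `0 ≤ C_χ`). [cite: BenfattoGiulianiMastropietro2006, §2.3 (2.36aa)] -/
theorem norm_iteratedFDeriv_uvWeightFn_band_le_gevrey (hΛ : 0 < Λ) (ω : ℝ) {n : ℕ} {X₀ Cχ : ℝ} (hX1 : 1 ≤ X₀) (hC : 0 ≤ Cχ)
    (hX : ∀ l ≤ n, ∀ x : ℝ, ‖iteratedFDeriv ℝ l salmhoferCutoff x‖ ≤ X₀ * ((l ! : ℝ)) ^ 2 * Cχ ^ l) (e : ℝ) :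
    ‖iteratedFDeriv ℝ n (fun t : ℝ => uvWeightFn Λ ω t) e‖ ≤ X₀ * ((n ! : ℝ)) ^ 2 * (16 * (1 + Cχ) / Λ) ^ n := by
  by_cases he : |e| ≤ Λ
  · -- on `|e| ≤ Λ`: Gevrey composition `χ₂ ∘ q`, `q(e) = (e²+ω²)/Λ²`, `‖Dⁱq‖ ≤ (4/Λ)ⁱ`
    have hcomp : (fun t : ℝ => uvWeightFn Λ ω t) = salmhoferCutoff ∘ (fun t : ℝ => (t ^ 2 + ω ^ 2) / Λ ^ 2) := by funext t; rfl
    rw [hcomp]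
    have hD : 2 * |e| / Λ ^ 2 + 2 / Λ ≤ 4 / Λ := by
      rw [div_add_div _ _ (by positivity) hΛ.ne', div_le_div_iff₀ (by positivity) hΛ]
      nlinarith [abs_nonneg e]
    have h := norm_iteratedFDeriv_comp_le_of_gevrey_two (F := ℝ) (G := ℝ) (f := fun t : ℝ => (t ^ 2 + ω ^ 2) / Λ ^ 2)
      (contDiff_bandQuad Λ ω) e (B := 1) (σ := 4 / Λ) (τ := Cχ) zero_le_one (by positivity) hC n
      (fun i hi1 _ => by
        refine (norm_iteratedFDeriv_bandQuad_le hΛ ω hi1 e).trans ?_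
        have hfac : (1 : ℝ) ≤ ((i ! : ℝ)) ^ 2 := one_le_pow₀ (by exact_mod_cast Nat.one_le_iff_ne_zero.2 (Nat.factorial_ne_zero i))
        calc (2 * |e| / Λ ^ 2 + 2 / Λ) ^ i ≤ (4 / Λ) ^ i := pow_le_pow_left₀ (by positivity) hD i
          _ ≤ 1 * ((i ! : ℝ)) ^ 2 * (4 / Λ) ^ i := by rw [one_mul]; exact le_mul_of_one_le_left (by positivity) hfac)
      (g := salmhoferCutoff) contDiff_salmhoferCutoff X₀ 0 (fun k hk => by rw [add_zero]; exact hX k hk _)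
    refine h.trans (le_of_eq ?_)
    rw [add_zero]
    congr 1
    ring
  · have hgt : Λ ^ 2 < ω ^ 2 + e ^ 2 := by
      have h1 : Λ < |e| := not_le.1 he
      have h2 : Λ ^ 2 < |e| ^ 2 := by gcongr
      rw [sq_abs] at h2
      nlinarith [sq_nonneg ω]
    rcases Nat.eq_zero_or_pos n with hn | hn
    · subst hn
      rw [norm_iteratedFDeriv_zero]
      have h0 := hX 0 le_rfl ((e ^ 2 + ω ^ 2) / Λ ^ 2)
      rw [norm_iteratedFDeriv_zero] at h0
      simpa [uvWeightFn_band_eq] using h0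
    · rw [iteratedFDeriv_uvWeightFn_band_eq_zero_of_gt hΛ hgt hn, norm_zero]
      positivity

/-- **The resolvent on the closed half-shell** `Λ²/4 ≤ ω² + e²`: `‖∂ⁿR(e)‖ ≤ |c|(2/Λ)·(n!)²·(2/Λ)ⁿ` (`‖−iω+e‖ ≥ Λ/2`, `n! ≤ (n!)²`).
[cite: BenfattoGiulianiMastropietro2006, §2.3 (2.36aa)] -/
theorem norm_iteratedFDeriv_resolventFnXi_le_of_halfShell (hΛ : 0 < Λ) (hω : ω ≠ 0) {e : ℝ} (h : Λ ^ 2 / 4 ≤ ω ^ 2 + e ^ 2) (n : ℕ) :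
    ‖iteratedFDeriv ℝ n (resolventFnXi c 0 ω) e‖ ≤ |c| * (2 / Λ) * ((n ! : ℝ)) ^ 2 * (2 / Λ) ^ n := by
  have hω0 : ω + 0 ≠ 0 := by rwa [add_zero]
  rw [norm_iteratedFDeriv_eq_norm_iteratedDeriv, norm_iteratedDeriv_resolventFnXi hω0]
  have hden : Λ / 2 ≤ ‖-I * ((ω + 0 : ℝ) : ℂ) + (e : ℂ)‖ := by
    refine (abs_le_of_sq_le_sq' ?_ (norm_nonneg _)).2
    rw [norm_sq_uvDen]; nlinarith
  have h2 : 0 < Λ / 2 := by positivity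
  have hfac : (n ! : ℝ) ≤ ((n ! : ℝ)) ^ 2 := by
    rw [sq]; exact le_mul_of_one_le_left (by positivity) (by exact_mod_cast Nat.one_le_iff_ne_zero.2 (Nat.factorial_ne_zero n))
  calc |c| * (n ! : ℝ) / ‖-I * ((ω + 0 : ℝ) : ℂ) + (e : ℂ)‖ ^ (n + 1) ≤ |c| * (n ! : ℝ) / (Λ / 2) ^ (n + 1) :=
        div_le_div_of_nonneg_left (by positivity) (by positivity) (pow_le_pow_left₀ h2.le hden _)
    _ = |c| * (2 / Λ) * (n ! : ℝ) * (2 / Λ) ^ n := by rw [div_eq_mul_inv, ← inv_pow, inv_div, pow_succ]; ring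
    _ ≤ |c| * (2 / Λ) * ((n ! : ℝ)) ^ 2 * (2 / Λ) ^ n := by gcongr

/-- **GEVREY-2 ENVELOPE OF THE SYMBOL JETS, EVERYWHERE**: `‖∂ⁿΨ(ω,e)‖ ≤ X₀·(|c|(2/Λ))·(n!)²·(2·(16(1+C_χ)/Λ))ⁿ` (`0 < Λ`, `ω ≠ 0`, Gevrey table for
`l ≤ n`, `1 ≤ X₀`, `0 ≤ C_χ`): below the shell `Ψ ≡ 0` near `e`; elsewhere Leibniz for `(n!)²`-geometric jets of weight × resolvent.
[cite: BenfattoGiulianiMastropietro2006, §2.3 (2.36aa)] -/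
theorem norm_iteratedFDeriv_uvSymbolFnXi_le_gevrey (hΛ : 0 < Λ) (hω : ω ≠ 0) {n : ℕ} {X₀ Cχ : ℝ} (hX1 : 1 ≤ X₀) (hC : 0 ≤ Cχ)
    (hX : ∀ l ≤ n, ∀ x : ℝ, ‖iteratedFDeriv ℝ l salmhoferCutoff x‖ ≤ X₀ * ((l ! : ℝ)) ^ 2 * Cχ ^ l) (e : ℝ) :
    ‖iteratedFDeriv ℝ n (uvSymbolFnXi c Λ ω) e‖ ≤ X₀ * (|c| * (2 / Λ)) * ((n ! : ℝ)) ^ 2 * (2 * (16 * (1 + Cχ) / Λ)) ^ n := by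
  have hω0 : ω + 0 ≠ 0 := by rwa [add_zero]
  by_cases h : ω ^ 2 + e ^ 2 < Λ ^ 2 / 4
  · rw [iteratedFDeriv_uvSymbolFnXi_eq_zero_of_lt hΛ h n, norm_zero]; positivity
  · have hge : Λ ^ 2 / 4 ≤ ω ^ 2 + e ^ 2 := not_lt.1 h
    rw [uvSymbolFnXi_eq_mul]
    have hw : ContDiff ℝ ((⊤ : ℕ∞) : WithTop ℕ∞) (fun t : ℝ => (Complex.ofRealLI ∘ fun t : ℝ => uvWeightFn Λ ω t) t) :=
      Complex.ofRealCLM.contDiff.comp (contDiff_uvWeightFn_band Λ ω)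
    have hR : ContDiff ℝ ((⊤ : ℕ∞) : WithTop ℕ∞) (resolventFnXi c 0 ω) := contDiff_resolventFnXi (c := c) hω0
    have hρ : 2 / Λ ≤ 16 * (1 + Cχ) / Λ := div_le_div_of_nonneg_right (by nlinarith) hΛ.le
    have hX0 : 0 ≤ X₀ := zero_le_one.trans hX1
    have hW : ∀ i ≤ n, ‖iteratedFDeriv ℝ i (fun t : ℝ => (Complex.ofRealLI ∘ fun t : ℝ => uvWeightFn Λ ω t) t) e‖ ≤
        X₀ * ((i ! : ℝ)) ^ 2 * (16 * (1 + Cχ) / Λ) ^ i := by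
      intro i hi
      have hcast : (fun t : ℝ => (Complex.ofRealLI ∘ fun t : ℝ => uvWeightFn Λ ω t) t) = Complex.ofRealLI ∘ (fun t : ℝ => uvWeightFn Λ ω t) := rfl
      rw [hcast, Complex.ofRealLI.norm_iteratedFDeriv_comp_left ((contDiff_uvWeightFn_band Λ ω (N := i)).contDiffAt) le_rfl]
      exact norm_iteratedFDeriv_uvWeightFn_band_le_gevrey hΛ ω hX1 hC (fun l hl x => hX l (hl.trans hi) x) e
    have hR' : ∀ i ≤ n, ‖iteratedFDeriv ℝ i (resolventFnXi c 0 ω) e‖ ≤ |c| * (2 / Λ) * ((i ! : ℝ)) ^ 2 * (16 * (1 + Cχ) / Λ) ^ i := fun i _ =>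
      (norm_iteratedFDeriv_resolventFnXi_le_of_halfShell hΛ hω hge i).trans
        (mul_le_mul_of_nonneg_left (pow_le_pow_left₀ (by positivity) hρ i) (by positivity))
    have h := norm_iteratedFDeriv_mul_le_of_factorialPow (a := 2) (b := 2) (A := X₀) (B := |c| * (2 / Λ)) (ρ := 16 * (1 + Cχ) / Λ)
      hw hR (by exact_mod_cast le_top) e hX0 (by positivity) (by positivity) hW hR'
    rw [max_self] at h
    exact h

end Literature.MathematicalPhysics.QuantumLattice

end
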